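import Summits.ABC.ABC.Theorems.TwistAmplificationSharpModerateLawPlanarityFactorisationLocal
import Summits.ABC.ABC.Theorems.TwistAmplificationSharpModerateLawFewDeepFlat
import Literature.NumberTheory.CubicFields.IrreducibleNondegenerate

/-!
# Crux `TwistAmplification.SharpModerateLaw` (stmt-ABC-1975), line `unit-plane-conic-two-torsion`:
the ideal factorisation `(a u + v ω) = 𝔞'·𝔟²` for the lever `stub_planarityFactorisation`

Third helper file of the stub `stub_planarityFactorisation : PlanarityFactorisation` (after
`…PlanarityFactorisationRing.lean` and `…PlanarityFactorisationLocal.lean`: `O = R(F)` Dedekind for irreducible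
maximal `F`; the degree-one primes `𝔓_q = (q, ω + c_q) = (q, a u + v ω)` of norm `q` at the primes `q ∤ a`
dividing `F(u, v)`, `(u, v)` coprime).  With `M = 6·|a|·|Disc F|` (`badModulus`), `m = |F(u, v)|`,
`m♭ = coprimePart M m`, `T = sqfreeKernel m♭`, `S = sqPart m♭` (objects of `…UnitPlaneDefs.lean` §1, arithmetic
from `…FewDeepFlat.lean`):

* factor `(a u + v ω) = ∏ 𝔮^{e_𝔮}` in `O` (`planeFactors`), `𝔟 = ∏ 𝔮^{⌊e_𝔮/2⌋}` (`sqIdeal`),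
  `𝔞' = ∏_{e_𝔮 odd} 𝔮` (`oddIdeal`), so `(a u + v ω) = 𝔞'·𝔟²` (`span_planeElt_eq`);
* at a flat prime `q ∣ m♭`: `𝔓_q` is a factor, it is the only factor whose norm `q` divides (the norm of a prime
  ideal is a power of the prime under it, `Ideal.exists_prime_and_absNorm_eq_pow`), hence comparing `q`-adic
  valuations in `|a|²·m = ∏ N𝔮^{e_𝔮}` gives **`e_{𝔓_q} = v_q(m)`** (`count_primeIdealAt`);
* **`S ∣ N𝔟`** (`sqPart_dvd_absNorm_sqIdeal`) and **`𝔞' = (∏_{q ∣ T} 𝔓_q) · 𝔞'_bad`** with `𝔞'_bad ∣ (M)`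
  (`oddIdeal_eq`, `oddBadIdeal_dvd_span`), so **`N𝔞' ≤ M³·T`** (`absNorm_oddIdeal_le`);
* the closed form `ideal_planarityFactorisation` (registered sub-goal of stmt-ABC-1975).
-/

noncomputable section

-- the mandated summit namespace `Summit.ABC.ABC` (summit = problem) trips the duplicate-namespace linter
set_option linter.dupNamespace false

namespace Summit.ABC.ABC.Theorems.SharpModerateLaw.UnitPlane

open Literature.NumberTheory.CubicFields
open RingOfForm (omega theta RatAlgebra)

/-! ## 1. Arithmetic of the flat part: `coprimePart`, `sqfreeKernel`, `sqPart` -/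

section Arith

/-- The prime factors of the coprime part. -/
theorem mem_primeFactors_coprimePart {s n q : ℕ} (hn : n ≠ 0) :
    q ∈ (coprimePart s n).primeFactors ↔ q.Prime ∧ q ∣ n ∧ ¬ q ∣ s := by
  rw [Nat.mem_primeFactors]
  constructor
  · rintro ⟨hq, hdvd, -⟩
    have hpos := hq.factorization_pos_of_dvd (coprimePart_pos s n).ne' hdvd
    rw [factorization_coprimePart hn hq] at hpos
    by_cases h : q ∣ s
    · rw [if_pos h] at hpos; exact absurd hpos (lt_irrefl 0)
    · rw [if_neg h] at hpos
      exact ⟨hq, Nat.dvd_of_factorization_pos hpos.ne', h⟩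
  · rintro ⟨hq, hdvd, hs⟩
    refine ⟨hq, Nat.dvd_of_factorization_pos ?_, (coprimePart_pos s n).ne'⟩
    rw [factorization_coprimePart hn hq, if_neg hs]
    exact (hq.factorization_pos_of_dvd hn hdvd).ne'

/-- `v_q` of the coprime part at a prime `q ∤ s`. -/
theorem factorization_coprimePart_of_not_dvd {s n q : ℕ} (hn : n ≠ 0) (hq : q.Prime) (hs : ¬ q ∣ s) :
    (coprimePart s n).factorization q = n.factorization q := by
  rw [factorization_coprimePart hn hq, if_neg hs]

/-- The members of the defining product of `sqfreeKernel n` are primes. -/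
theorem primeFactors_sqfreeKernel (n : ℕ) :
    (sqfreeKernel n).primeFactors = n.primeFactors.filter fun p => ¬ 2 ∣ n.factorization p :=
  Nat.primeFactors_prod fun _ hp => Nat.prime_of_mem_primeFactors (Finset.mem_filter.mp hp).1

/-- Membership in the prime factors of the square-free kernel. -/
theorem mem_primeFactors_sqfreeKernel {n q : ℕ} :
    q ∈ (sqfreeKernel n).primeFactors ↔ q ∈ n.primeFactors ∧ ¬ 2 ∣ n.factorization q := by
  rw [primeFactors_sqfreeKernel, Finset.mem_filter]

/-- `sqfreeKernel n` is the product of its prime factors. -/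
theorem sqfreeKernel_eq_prod_primeFactors (n : ℕ) : sqfreeKernel n = ∏ p ∈ (sqfreeKernel n).primeFactors, p := by
  rw [primeFactors_sqfreeKernel]; rfl

/-- `sqfreeKernel n ≠ 0`. -/
theorem sqfreeKernel_ne_zero (n : ℕ) : sqfreeKernel n ≠ 0 :=
  Finset.prod_ne_zero_iff.mpr fun _ hp => (Nat.prime_of_mem_primeFactors (Finset.mem_filter.mp hp).1).ne_zero

end Arith

/-! ## 2. The factorisation `(a u + v ω) = 𝔞'·𝔟²` in the Dedekind domain `R(F)` -/

section Ideals

variable {F : BinaryCubic ℤ}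

/-- The bad modulus `M = 6·|a|·|Disc F|` (primes of `6`, of `a` and of the discriminant). -/
def badModulus (F : BinaryCubic ℤ) : ℕ := 6 * F.a.natAbs * F.disc.natAbs

/-- `M ≠ 0` for irreducible `F`. -/
theorem badModulus_ne_zero (hirr : F.IsIrreducible) : badModulus F ≠ 0 := by
  have ha := hirr.1
  have hD := BinaryCubic.disc_ne_zero_of_isIrreducible hirr
  simp [badModulus, ha, hD]

/-- A number prime to `M` does not divide `a`. -/
theorem not_dvd_a_of_not_dvd_badModulus {q : ℕ} (h : ¬ q ∣ badModulus F) : ¬ (q : ℤ) ∣ F.a := by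
  intro h'
  rw [Int.natCast_dvd] at h'
  exact h ((h'.mul_left 6).mul_right _)

variable [hF : Fact F.IsIrreducible] [hM : Fact (RingOfForm.IsMaximal F)]

variable (F) in
/-- The prime ideal factors (with multiplicity) of `(a u + v ω)`. -/
def planeFactors (u v : ℤ) :
    Multiset (Ideal (RingOfForm F)) :=
  UniqueFactorizationMonoid.normalizedFactors (Ideal.span {planeElt F u v})

open scoped Classical in
variable (F) in
/-- `𝔟 = ∏ 𝔮^{⌊e_𝔮/2⌋}` over the factorisation `(a u + v ω) = ∏ 𝔮^{e_𝔮}`. -/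
def sqIdeal (u v : ℤ) :
    Ideal (RingOfForm F) :=
  ∏ P ∈ (planeFactors F u v).toFinset, P ^ ((planeFactors F u v).count P / 2)

open scoped Classical in
variable (F) in
/-- `𝔞' = ∏_{e_𝔮 odd} 𝔮`. -/
def oddIdeal (u v : ℤ) :
    Ideal (RingOfForm F) :=
  ∏ P ∈ (planeFactors F u v).toFinset with ¬ 2 ∣ (planeFactors F u v).count P, P

open scoped Classical in
variable (F) in
/-- The BAD part of `𝔞'`: the odd-exponent primes whose norm is not prime to `M`. -/
def oddBadIdeal (u v : ℤ) :
    Ideal (RingOfForm F) :=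
  ∏ P ∈ (planeFactors F u v).toFinset with
    (¬ 2 ∣ (planeFactors F u v).count P ∧ ¬ (Ideal.absNorm P).Coprime (badModulus F)), P

section Datum

variable {u v : ℤ} (huv : IsCoprime u v) (h0 : F.eval u v ≠ 0)
include h0

omit hM in
/-- `a u + v ω ≠ 0` (its norm `a² F(u,v)` is nonzero). -/
theorem planeElt_ne_zero : planeElt F u v ≠ 0 := by
  intro h
  have hn := norm_planeElt F u v
  rw [h, Algebra.norm_zero] at hn
  exact mul_ne_zero (pow_ne_zero 2 hF.out.1) h0 hn.symm

omit hM in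
/-- `(a u + v ω) ≠ ⊥`. -/
theorem span_planeElt_ne_bot : Ideal.span {planeElt F u v} ≠ ⊥ := by
  rw [Ne, Ideal.span_singleton_eq_bot]; exact planeElt_ne_zero h0

omit h0 in
/-- `N((a u + v ω)) = |a|²·|F(u, v)|`. -/
theorem absNorm_span_planeElt :
    Ideal.absNorm (Ideal.span {planeElt F u v}) = F.a.natAbs ^ 2 * (F.eval u v).natAbs := by
  rw [Ideal.absNorm_span_singleton, norm_planeElt, Int.natAbs_mul, Int.natAbs_pow]

omit h0 in
/-- Members of `planeFactors` are prime ideals containing `a u + v ω`. -/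
theorem isPrime_of_mem_planeFactors {P : Ideal (RingOfForm F)} (hP : P ∈ planeFactors F u v) (h0 : F.eval u v ≠ 0) :
    P.IsPrime ∧ planeElt F u v ∈ P ∧ P ≠ ⊥ := by
  have h := (Ideal.mem_normalizedFactors_iff (span_planeElt_ne_bot h0)).mp hP
  exact ⟨h.1, (Ideal.span_singleton_le_iff_mem _).mp h.2,
    (UniqueFactorizationMonoid.prime_of_normalized_factor P hP).ne_zero⟩

/-- **`(a u + v ω) = 𝔞'·𝔟²`.** -/
theorem span_planeElt_eq : Ideal.span {planeElt F u v} = oddIdeal F u v * sqIdeal F u v ^ 2 := by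
  classical
  have hprod := Ideal.prod_normalizedFactors_eq_self (span_planeElt_ne_bot h0)
  rw [Finset.prod_multiset_count] at hprod
  change ∏ P ∈ (planeFactors F u v).toFinset, P ^ (planeFactors F u v).count P = _ at hprod
  rw [← hprod, oddIdeal, sqIdeal, Finset.prod_filter, ← Finset.prod_pow, ← Finset.prod_mul_distrib]
  refine Finset.prod_congr rfl fun P _ => ?_
  rw [← pow_mul]
  rcases Nat.even_or_odd ((planeFactors F u v).count P) with ⟨k, hk⟩ | ⟨k, hk⟩
  · rw [if_neg (by omega), one_mul, hk, show (k + k) / 2 * 2 = k + k by omega]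
  · rw [if_pos (by omega), hk, show (2 * k + 1) / 2 * 2 = 2 * k by omega, pow_succ, mul_comm]

/-- `N((a u + v ω)) = ∏ N𝔮^{e_𝔮}`. -/
theorem absNorm_span_planeElt_eq_prod :
    F.a.natAbs ^ 2 * (F.eval u v).natAbs =
      ∏ P ∈ (planeFactors F u v).toFinset, Ideal.absNorm P ^ (planeFactors F u v).count P := by
  classical
  have hprod := Ideal.prod_normalizedFactors_eq_self (span_planeElt_ne_bot h0)
  rw [Finset.prod_multiset_count] at hprod
  change ∏ P ∈ (planeFactors F u v).toFinset, P ^ (planeFactors F u v).count P = _ at hprod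
  rw [← absNorm_span_planeElt, ← hprod, map_prod]
  simp_rw [map_pow]

include huv

omit hF hM huv in
/-- A prime `q` of the flat part `m♭`: `q ∤ a`, `q ∣ F(u,v)`, and the local lemma applies. -/
theorem flatPrime_spec {q : ℕ} (hq : q ∈ (coprimePart (badModulus F) (F.eval u v).natAbs).primeFactors) :
    q.Prime ∧ ¬ (q : ℤ) ∣ F.a ∧ (q : ℤ) ∣ F.eval u v := by
  obtain ⟨hqp, hqm, hqM⟩ := (mem_primeFactors_coprimePart (Int.natAbs_ne_zero.mpr h0)).mp hq
  exact ⟨hqp, not_dvd_a_of_not_dvd_badModulus hqM, Int.natCast_dvd.mpr hqm⟩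

/-- The prime of the datum at a flat prime `q` lies in `planeFactors`. -/
theorem primeIdealAt_mem_planeFactors {q : ℕ} (hq : q ∈ (coprimePart (badModulus F) (F.eval u v).natAbs).primeFactors) :
    primeIdealAt F q (residueAt F u v q) ∈ planeFactors F u v := by
  obtain ⟨hqp, hqa, hqF⟩ := flatPrime_spec h0 hq
  rw [planeFactors, Ideal.mem_normalizedFactors_iff (span_planeElt_ne_bot h0), Ideal.span_singleton_le_iff_mem]
  exact ⟨isPrime_primeIdealAt hqp hqa (residueAt_mem_shapeRoots hqp hqa huv hqF),
    planeElt_mem_primeIdealAt hqp hqa huv hqF⟩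

/-- A factor `𝔮` of `(a u + v ω)` whose norm is divisible by the flat prime `q` IS the prime of the datum
at `q` (the norm of `𝔮` is a power of the prime under it). -/
theorem eq_primeIdealAt_of_dvd_absNorm {q : ℕ} (hq : q ∈ (coprimePart (badModulus F) (F.eval u v).natAbs).primeFactors)
    {P : Ideal (RingOfForm F)} (hP : P ∈ planeFactors F u v) (hdvd : q ∣ Ideal.absNorm P) :
    P = primeIdealAt F q (residueAt F u v q) := by
  obtain ⟨hqp, hqa, hqF⟩ := flatPrime_spec h0 hq
  obtain ⟨hPp, hxP, hP0⟩ := isPrime_of_mem_planeFactors hP h0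
  haveI := hPp.isMaximal hP0
  obtain ⟨p, n, -, hpP, hp, hN⟩ := Ideal.exists_prime_and_absNorm_eq_pow P
  rw [hN] at hdvd
  have hpq : q = p := (Nat.prime_dvd_prime_iff_eq hqp hp).mp (hqp.dvd_of_dvd_pow hdvd)
  subst hpq
  exact eq_primeIdealAt_of_mem hqp hqa huv hqF hPp hpP hxP

/-- **`e_𝔓 = v_q(F(u, v))`** at a flat prime `q`: compare `q`-adic valuations in `N(a u + vω) = ∏ N𝔮^{e_𝔮}`
(`N𝔓 = q`, and no other factor has norm divisible by `q`). -/
theorem count_primeIdealAt {q : ℕ} (hq : q ∈ (coprimePart (badModulus F) (F.eval u v).natAbs).primeFactors) :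
    (planeFactors F u v).count (primeIdealAt F q (residueAt F u v q)) = (F.eval u v).natAbs.factorization q := by
  classical
  obtain ⟨hqp, hqa, hqF⟩ := flatPrime_spec h0 hq
  set 𝔓 := primeIdealAt F q (residueAt F u v q)
  have hN𝔓 : Ideal.absNorm 𝔓 = q := absNorm_primeIdealAt hqp hqa (residueAt_mem_shapeRoots hqp hqa huv hqF)
  have hm0 : (F.eval u v).natAbs ≠ 0 := Int.natAbs_ne_zero.mpr h0
  have ha0 : F.a.natAbs ≠ 0 := Int.natAbs_ne_zero.mpr hF.out.1
  have key := congrArg (fun n => n.factorization q) (absNorm_span_planeElt_eq_prod h0)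
  rw [Nat.factorization_mul (pow_ne_zero 2 ha0) hm0, Nat.factorization_pow, Finsupp.add_apply, Finsupp.smul_apply,
    Nat.factorization_eq_zero_of_not_dvd (fun h => hqa (Int.natCast_dvd.mpr h)), smul_zero, zero_add,
    Nat.factorization_prod fun P hP =>
      pow_ne_zero _ (Ideal.absNorm_eq_zero_iff.not.mpr (isPrime_of_mem_planeFactors (Multiset.mem_toFinset.mp hP) h0).2.2),
    Finset.sum_apply'] at key
  rw [key, Finset.sum_eq_single_of_mem 𝔓 (Multiset.mem_toFinset.mpr (primeIdealAt_mem_planeFactors huv h0 hq))]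
  · rw [Nat.factorization_pow, Finsupp.smul_apply, hN𝔓, hqp.factorization_self, smul_eq_mul, mul_one]
  · intro P hP hne
    rw [Nat.factorization_pow, Finsupp.smul_apply, Nat.factorization_eq_zero_of_not_dvd, smul_zero]
    exact fun hdvd => hne (eq_primeIdealAt_of_dvd_absNorm huv h0 hq (Multiset.mem_toFinset.mp hP) hdvd)

/-- `q ↦ 𝔓_q` is injective on the flat primes. -/
theorem primeIdealAt_injOn :
    Set.InjOn (fun q => primeIdealAt F q (residueAt F u v q))
      ((coprimePart (badModulus F) (F.eval u v).natAbs).primeFactors : Set ℕ) := by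
  intro q₁ h₁ q₂ h₂ h
  obtain ⟨hp₁, ha₁, hF₁⟩ := flatPrime_spec h0 h₁
  obtain ⟨hp₂, ha₂, hF₂⟩ := flatPrime_spec h0 h₂
  have := congrArg Ideal.absNorm h
  simp only at this
  rwa [absNorm_primeIdealAt hp₁ ha₁ (residueAt_mem_shapeRoots hp₁ ha₁ huv hF₁),
    absNorm_primeIdealAt hp₂ ha₂ (residueAt_mem_shapeRoots hp₂ ha₂ huv hF₂)] at this

/-- **`S ∣ N𝔟`**: `S = ∏_{q ∣ m♭} q^{⌊v_q/2⌋} = ∏_{q} N(𝔓_q)^{⌊e_{𝔓_q}/2⌋}` divides `N𝔟 = ∏_𝔮 N𝔮^{⌊e_𝔮/2⌋}`. -/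
theorem sqPart_dvd_absNorm_sqIdeal :
    sqPart (coprimePart (badModulus F) (F.eval u v).natAbs) ∣ Ideal.absNorm (sqIdeal F u v) := by
  classical
  set mf := coprimePart (badModulus F) (F.eval u v).natAbs
  have hm0 : (F.eval u v).natAbs ≠ 0 := Int.natAbs_ne_zero.mpr h0
  rw [sqIdeal, map_prod]
  have hS : sqPart mf = ∏ P ∈ mf.primeFactors.image (fun q => primeIdealAt F q (residueAt F u v q)),
      Ideal.absNorm (P ^ ((planeFactors F u v).count P / 2)) := by
    rw [Finset.prod_image (primeIdealAt_injOn huv h0), sqPart]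
    refine Finset.prod_congr rfl fun q hq => ?_
    obtain ⟨hqp, hqa, hqF⟩ := flatPrime_spec h0 hq
    rw [map_pow, absNorm_primeIdealAt hqp hqa (residueAt_mem_shapeRoots hqp hqa huv hqF), count_primeIdealAt huv h0 hq,
      factorization_coprimePart_of_not_dvd hm0 hqp ((mem_primeFactors_coprimePart hm0).mp hq).2.2]
  rw [hS]
  exact Finset.prod_dvd_prod_of_subset _ _ _ (Finset.image_subset_iff.mpr fun q hq =>
    Multiset.mem_toFinset.mpr (primeIdealAt_mem_planeFactors huv h0 hq))

/-- The GOOD odd-exponent factors are exactly the primes of the datum at the primes of `T = sqfreeKernel m♭`. -/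
theorem filter_odd_good_eq_image :
    ((planeFactors F u v).toFinset.filter fun P =>
        ¬ 2 ∣ (planeFactors F u v).count P ∧ (Ideal.absNorm P).Coprime (badModulus F)) =
      (sqfreeKernel (coprimePart (badModulus F) (F.eval u v).natAbs)).primeFactors.image
        fun q => primeIdealAt F q (residueAt F u v q) := by
  classical
  set mf := coprimePart (badModulus F) (F.eval u v).natAbs
  have hm0 : (F.eval u v).natAbs ≠ 0 := Int.natAbs_ne_zero.mpr h0
  have ha0 : F.a.natAbs ≠ 0 := Int.natAbs_ne_zero.mpr hF.out.1
  ext P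
  simp only [Finset.mem_filter, Multiset.mem_toFinset, Finset.mem_image, mem_primeFactors_sqfreeKernel]
  constructor
  · rintro ⟨hP, hodd, hgood⟩
    obtain ⟨hPp, hxP, hP0⟩ := isPrime_of_mem_planeFactors hP h0
    haveI := hPp.isMaximal hP0
    obtain ⟨p, n, hn, hpP, hp, hN⟩ := Ideal.exists_prime_and_absNorm_eq_pow P
    -- `p` is a flat prime: `p ∣ N𝔮 ∣ |a|² m`, `p ∤ M ⊇ primes of a`
    have hpN : p ∣ Ideal.absNorm P := by rw [hN]; exact dvd_pow_self p hn.ne'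
    have hpM : ¬ p ∣ badModulus F := fun h =>
      (Nat.coprime_primes hp hp).mp ((hgood.of_dvd_left hpN).of_dvd_right h) rfl
    have hpm : p ∣ (F.eval u v).natAbs := by
      have h1 : Ideal.absNorm P ∣ F.a.natAbs ^ 2 * (F.eval u v).natAbs := by
        rw [← absNorm_span_planeElt]
        exact Ideal.absNorm_dvd_absNorm_of_le ((Ideal.span_singleton_le_iff_mem _).mpr hxP)
      rcases (Nat.Prime.dvd_mul hp).mp (hpN.trans h1) with h | h
      · exact absurd (Int.natCast_dvd.mpr (hp.dvd_of_dvd_pow h)) (not_dvd_a_of_not_dvd_badModulus hpM)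
      · exact h
    have hpf : p ∈ mf.primeFactors := (mem_primeFactors_coprimePart hm0).mpr ⟨hp, hpm, hpM⟩
    have hPeq : P = primeIdealAt F p (residueAt F u v p) := eq_primeIdealAt_of_dvd_absNorm huv h0 hpf hP hpN
    refine ⟨p, ⟨hpf, ?_⟩, hPeq.symm⟩
    rwa [factorization_coprimePart_of_not_dvd hm0 hp hpM, ← count_primeIdealAt huv h0 hpf, ← hPeq]
  · rintro ⟨q, ⟨hqf, hodd⟩, rfl⟩
    obtain ⟨hqp, hqa, hqF⟩ := flatPrime_spec h0 hqf
    refine ⟨primeIdealAt_mem_planeFactors huv h0 hqf, ?_, ?_⟩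
    · rwa [count_primeIdealAt huv h0 hqf, ← factorization_coprimePart_of_not_dvd hm0 hqp
        ((mem_primeFactors_coprimePart hm0).mp hqf).2.2]
    · rw [absNorm_primeIdealAt hqp hqa (residueAt_mem_shapeRoots hqp hqa huv hqF)]
      exact (Nat.Prime.coprime_iff_not_dvd hqp).mpr ((mem_primeFactors_coprimePart hm0).mp hqf).2.2

/-- **`𝔞' = (∏_{q ∣ T} 𝔓_q) · 𝔞'_bad`.** -/
theorem oddIdeal_eq :
    oddIdeal F u v =
      (∏ q ∈ (sqfreeKernel (coprimePart (badModulus F) (F.eval u v).natAbs)).primeFactors,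
          primeIdealAt F q (residueAt F u v q)) * oddBadIdeal F u v := by
  classical
  have hinj : Set.InjOn (fun q => primeIdealAt F q (residueAt F u v q))
      ((sqfreeKernel (coprimePart (badModulus F) (F.eval u v).natAbs)).primeFactors : Set ℕ) :=
    fun q₁ h₁ q₂ h₂ h => primeIdealAt_injOn huv h0 (mem_primeFactors_sqfreeKernel.mp h₁).1
      (mem_primeFactors_sqfreeKernel.mp h₂).1 h
  rw [oddIdeal, oddBadIdeal,
    ← Finset.prod_filter_mul_prod_filter_not ((planeFactors F u v).toFinset.filter fun P => ¬ 2 ∣ (planeFactors F u v).count P)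
      (fun P => (Ideal.absNorm P).Coprime (badModulus F)),
    Finset.filter_filter, Finset.filter_filter, filter_odd_good_eq_image huv h0, Finset.prod_image hinj]

omit huv in
/-- **The bad part divides `(M)`**: each of its (distinct) primes has norm `p^f` with `p ∣ M`, so contains `M`. -/
theorem oddBadIdeal_dvd_span : oddBadIdeal F u v ∣ Ideal.span {(badModulus F : RingOfForm F)} := by
  classical
  refine Finset.prod_primes_dvd _ (fun P hP => ?_) (fun P hP => ?_)
  · obtain ⟨hP, -, -⟩ := Finset.mem_filter.mp hP
    obtain ⟨hPp, -, hP0⟩ := isPrime_of_mem_planeFactors (Multiset.mem_toFinset.mp hP) h0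
    exact Ideal.prime_of_isPrime hP0 hPp
  · obtain ⟨hP, -, hbad⟩ := Finset.mem_filter.mp hP
    obtain ⟨hPp, -, hP0⟩ := isPrime_of_mem_planeFactors (Multiset.mem_toFinset.mp hP) h0
    haveI := hPp.isMaximal hP0
    obtain ⟨p, n, hn, hpP, hp, hN⟩ := Ideal.exists_prime_and_absNorm_eq_pow P
    rw [hN] at hbad
    have hpM : p ∣ badModulus F := by
      by_contra h
      exact hbad (Nat.Coprime.pow_left n ((Nat.Prime.coprime_iff_not_dvd hp).mpr h))
    rw [Ideal.dvd_span_singleton]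
    obtain ⟨k, hk⟩ := hpM
    rw [hk, Nat.cast_mul]
    exact P.mul_mem_right _ hpP

omit huv in
/-- `N(𝔞'_bad) ≤ M³`. -/
theorem absNorm_oddBadIdeal_le : Ideal.absNorm (oddBadIdeal F u v) ≤ badModulus F ^ 3 := by
  have h := Ideal.absNorm_dvd_absNorm_of_le (Ideal.le_of_dvd (oddBadIdeal_dvd_span h0))
  rw [Ideal.absNorm_span_natCast, RingOfForm.finrank_eq_three] at h
  exact Nat.le_of_dvd (pow_pos (Nat.pos_of_ne_zero (badModulus_ne_zero hF.out)) 3) h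

/-- **`N𝔞' ≤ M³ · T`** (`N(∏_{q ∣ T} 𝔓_q) = ∏_{q ∣ T} q = T`). -/
theorem absNorm_oddIdeal_le :
    Ideal.absNorm (oddIdeal F u v) ≤
      badModulus F ^ 3 * sqfreeKernel (coprimePart (badModulus F) (F.eval u v).natAbs) := by
  rw [oddIdeal_eq huv h0, map_mul, map_prod, mul_comm]
  refine Nat.mul_le_mul (absNorm_oddBadIdeal_le h0) (le_of_eq ?_)
  conv_rhs => rw [sqfreeKernel_eq_prod_primeFactors]
  refine Finset.prod_congr rfl fun q hq => ?_
  obtain ⟨hqp, hqa, hqF⟩ := flatPrime_spec h0 (mem_primeFactors_sqfreeKernel.mp hq).1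
  exact absNorm_primeIdealAt hqp hqa (residueAt_mem_shapeRoots hqp hqa huv hqF)

omit huv in
/-- `𝔟 ≠ ⊥`. -/
theorem sqIdeal_ne_bot : sqIdeal F u v ≠ ⊥ := by
  intro h
  have := span_planeElt_eq h0 (F := F)
  rw [h, ← Ideal.zero_eq_bot, zero_pow two_ne_zero, mul_zero, Ideal.zero_eq_bot] at this
  exact span_planeElt_ne_bot h0 this

end Datum

/-- **Ideal-level planarity factorisation** (registered sub-goal `ideal_planarityFactorisation` of stmt-ABC-1975):
for an irreducible maximal `F` and a coprime datum `(u, v)` with `F(u, v) ≠ 0`, `(a u + v ω) = 𝔞'·𝔟²` in `R(F)`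
with `S ∣ N𝔟 = #(R(F)/𝔟)` and `N𝔞' ≤ M³·T` (`M = 6|a||Disc F|`; `T`, `S` the square-free kernel and square part
of the part of `|F(u, v)|` prime to `M`). -/
theorem ideal_planarityFactorisation : ∀ (F : BinaryCubic ℤ), F.IsIrreducible → RingOfForm.IsMaximal F → ∀ (u v : ℤ), IsCoprime u v → F.eval u v ≠ 0 → ∃ 𝔞 𝔟 : Ideal (RingOfForm F), Ideal.span {planeElt F u v} = 𝔞 * 𝔟 ^ 2 ∧ sqPart (coprimePart (6 * F.a.natAbs * F.disc.natAbs) (F.eval u v).natAbs) ∣ Nat.card (RingOfForm F ⧸ 𝔟) ∧ Nat.card (RingOfForm F ⧸ 𝔞) ≤ (6 * F.a.natAbs * F.disc.natAbs) ^ 3 * sqfreeKernel (coprimePart (6 * F.a.natAbs * F.disc.natAbs) (F.eval u v).natAbs) := by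
  intro F hirr hmax u v huv h0
  haveI : Fact F.IsIrreducible := ⟨hirr⟩
  haveI : Fact (RingOfForm.IsMaximal F) := ⟨hmax⟩
  refine ⟨oddIdeal F u v, sqIdeal F u v, span_planeElt_eq h0, ?_, ?_⟩
  · have h := sqPart_dvd_absNorm_sqIdeal huv h0
    rwa [Ideal.absNorm_apply, Submodule.cardQuot_apply] at h
  · have h := absNorm_oddIdeal_le huv h0
    rwa [Ideal.absNorm_apply, Submodule.cardQuot_apply] at h

end Ideals

end Summit.ABC.ABC.Theorems.SharpModerateLaw.UnitPlane

end
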